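import Summits.ValiantsHypothesis.ValiantsHypothesis.Theorems.LacunarySymmetroidMatrixDescartesCensusV19GCheck

/-!
# `MatrixDescartes` census — the 2-SIDON `V = 19` checker with general window rows AND RATIO SPLITS (`V19T`; definitions)

HONEST FRAMING.  Object-search cell `pub-symmetroid`; door-A item `DoorA26 = PosRootLawAt 2 6 19` (stmt-ValiantsHypothesis-19979; OPEN, typed,
never asserted) and its sharper support rows `PosRootLawOn 2 6 18 d`.  DEFINITIONS ONLY (val-sym-door-p4 g6): a certificate language and Boolean
checker that EXTEND val-sym-door-p5 g5's `…CensusV19GCheck` (imported UNCHANGED: contexts, modes, the rows `c25 / win / one / amgm / gwin`, the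
sign / all-negative checks, the slices) by CASE SPLITS ON A MONOMIAL INEQUALITY — the «ratio splits» of the cell's search trees (`a19split`): a
certificate may be a binary tree whose internal node carries an explicit row `r` (positions with multiplicity on both sides, natural constants);
the first subtree is checked with `r` available as a HYPOTHESIS ROW (`TRow.hyp i` = the `i`-th hypothesis collected along the path), the second
with the SWAPPED row (sides and constants exchanged).  Since the unknowns are positive reals, one of the two inequalities always holds, so a tree
all of whose leaves are refuted refutes the cell (soundness in `…CensusV19TSound`).  Leaves are `V19G`'s (`sign / signNull / allneg / lp / dom`,
rows over `TRow`); the top level keeps `V19G`'s middle-window disjunction `branch2`, now with a tree per branch; `checkCells` has the eight-slice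
shape of `V19S` / `V19G`.  Nothing here bears on the one-collision supports, on `ζ_sym(2,6)` over all supports, on `MatrixDescartes`
(stmt-ValiantsHypothesis-18050) or on `VP ≠ VNP`.

[folklore] Bookkeeping / certificate replay; elementary.
-/

-- the D-0017 layout repeats a namespace component (single-conjunct summit); the `dupNamespace` linter flags it; name mandated.
set_option linter.dupNamespace false

namespace Summit.ValiantsHypothesis.ValiantsHypothesis.Theorems.LacunarySymmetroidMatrixDescartes.Census.V19T

open V20 (Atom allAtoms sortAtoms ordOK Term PolySpec posl FNat Row mulF divF numZ denZ accumulate bumps)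
open V19S (Mode Ctx mkCtx termZero termNeg posTerms defOK signOK signNullOK allnegOK sliceA sliceB)
open V19G (GRow)

/-! ## Hypothesis rows and split trees -/

/-- A row reference of a `V19T` certificate: a `V19G` row, or the `i`-th hypothesis row of the current branch. [folklore] -/
inductive TRow where
  /-- a row of the `V19G` language (`c25 / win / one / amgm / gwin`) -/
  | g (r : GRow)
  /-- the `i`-th hypothesis row collected along the split path -/
  | hyp (i : ℕ)

/-- The row with sides and constants exchanged (the other half of the dichotomy). [folklore] -/
def swapRow (r : Row) : Row := { L := r.R, R := r.L, Bnum := r.Bden, Bden := r.Bnum }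

/-- Boolean well-formedness of an explicit row: positions among the 21, constant bases positive (`V20.Row.WF`). [folklore] -/
def rowWF (r : Row) : Bool :=
  (r.L.all fun p => decide (p < 21)) && (r.R.all fun p => decide (p < 21)) &&
    (r.Bnum.all fun be => decide (0 < be.1)) && (r.Bden.all fun be => decide (0 < be.1))

/-- Resolve a row reference in the context `c` under the hypotheses `H`. [folklore] -/
def buildRow (c : Ctx) (H : List Row) : TRow → Option Row
  | .g r => V19G.buildRow c r
  | .hyp i => H[i]?

/-- Resolve a list of row references with multipliers (fails if one reference fails). [folklore] -/
def buildRows (c : Ctx) (H : List Row) : List (TRow × ℕ) → Option (List (Row × ℕ))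
  | [] => some []
  | (rs, n) :: rest =>
    match buildRow c H rs, buildRows c H rest with
    | some r, some rr => some ((r, n) :: rr)
    | _, _ => none

/-! ## Certificates -/

/-- A competitor of a domination certificate (as `V19G.Comp`, rows over `TRow`). [folklore] -/
structure Comp where
  /-- index of the positive term -/
  k : ℕ
  /-- rows with multipliers -/
  rows : List (TRow × ℕ)
  /-- root degree -/
  D : ℕ
  /-- numerator of the bound -/
  un : ℕ

/-- Leaf certificates that a cell (under the current hypotheses) carries no nineteen (as `V19G.Cert0`, rows over `TRow`). [folklore] -/
inductive Cert0 where
  /-- odd triangle through three definite letters `i < j < k` -/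
  | sign (i j k : ℕ)
  /-- odd triangle through the NULL letter `n` and definite letters `a < b` -/
  | signNull (n a b : ℕ)
  /-- every non-zero term of the inequality `P ≥ 0` is negative -/
  | allneg (P : PolySpec)
  /-- Farkas combination of rows -/
  | lp (rows : List (TRow × ℕ))
  /-- single-monomial domination of `P ≥ 0`: negative term `n0`, common denominator `ud`, competitors -/
  | dom (P : PolySpec) (n0 : ℕ) (ud : ℕ) (comps : List Comp)

/-- Split trees: a leaf, or a case split on an explicit row `r` (first subtree: `r` holds; second: the swapped row holds). [folklore] -/
inductive Cert where
  /-- a leaf certificate -/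
  | leaf (ct : Cert0)
  /-- dichotomy `r ∨ swapRow r`, one subtree per case -/
  | split (r : Row) (c1 c2 : Cert)

/-- Top-level certificates of a cell: a split tree, or `V19G`'s middle-window disjunction with one split tree per branch. [folklore] -/
inductive Top where
  /-- a split tree for the cell itself -/
  | node (t : Cert)
  /-- `2·max(middle terms) ≥ outer sum`: `tK` with the `k`-th, `tK1` with the `(k+1)`-th middle term doubled -/
  | branch2 (tK tK1 : Cert)

/-- Check an LP (Farkas) certificate under hypotheses: balance of exponents and `∏ Bden^N > ∏ Bnum^N`. [folklore] -/
def lpOK (c : Ctx) (H : List Row) (rows : List (TRow × ℕ)) : Bool :=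
  match buildRows c H rows with
  | none => false
  | some rs =>
    let acc := accumulate rs
    decide (acc.1 = acc.2.1) && decide (denZ acc.2.2 < numZ acc.2.2)

/-- Check one competitor of a domination certificate under hypotheses. [folklore] -/
def compOK (c : Ctx) (H : List Row) (P : List Term) (n0 ud : ℕ) (cp : Comp) : Bool :=
  match buildRows c H cp.rows with
  | none => false
  | some rs =>
    let acc := accumulate rs
    let T0 := P.getD n0 (0, [])
    let Tk := P.getD cp.k (0, [])
    let A := divF (mulF acc.2.2 [(cp.un * T0.1.natAbs, cp.D)] 1) [(Tk.1.natAbs * ud, cp.D)] 1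
    decide (0 < cp.D) && decide (0 < cp.un) &&
      decide (bumps acc.1 (posl c.ord T0.2) cp.D = bumps acc.2.1 (posl c.ord Tk.2) cp.D) &&
      decide (denZ A ≤ numZ A)

/-- Check a domination certificate under hypotheses. [folklore] -/
def domOK (c : Ctx) (H : List Row) (P : PolySpec) (n0 ud : ℕ) (comps : List Comp) : Bool :=
  let poly := P.poly
  let pos := posTerms c poly
  P.valid && defOK c P && decide (n0 < poly.length) && !termZero c (poly.getD n0 (0, [])) && termNeg c (poly.getD n0 (0, [])) &&
    decide (0 < ud) &&
    decide (∀ k ∈ pos, ∃ cp ∈ comps, cp.k = k) && decide (∀ cp ∈ comps, cp.k ∈ pos) &&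
    decide ((comps.map Comp.k).Nodup) &&
    decide ((comps.map Comp.un).sum < ud) &&
    comps.all (compOK c H poly n0 ud)

/-- Check a leaf certificate for a cell under hypotheses. [folklore] -/
def cert0OK (c : Ctx) (H : List Row) : Cert0 → Bool
  | .sign i j k => signOK c i j k
  | .signNull n a b => signNullOK c n a b
  | .allneg P => allnegOK c P
  | .lp rows => lpOK c H rows
  | .dom P n0 ud comps => domOK c H P n0 ud comps

/-- Check a split tree for a cell: leaves under the hypotheses collected so far; a split node appends its row (resp. the swapped row)
to the hypotheses of its first (resp. second) subtree, after checking the row's well-formedness. [folklore] -/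
def certOK (c : Ctx) : List Row → Cert → Bool
  | H, .leaf ct => cert0OK c H ct
  | H, .split r c1 c2 => rowWF r && certOK c (H ++ [r]) c1 && certOK c (H ++ [swapRow r]) c2

/-- Check a top-level certificate for a cell (no hypotheses at the root): a split tree, or (mode `A` with a middle window) one split tree
per branch of the disjunction. [folklore] -/
def topOK (c : Ctx) : Top → Bool
  | .node t => certOK c [] t
  | .branch2 tK tK1 =>
    match c.mode with
    | .A k => decide (1 ≤ k ∧ k + 2 ≤ 20) && certOK { c with mid := some k } [] tK && certOK { c with mid := some (k + 1) } [] tK1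
    | .B _ => false

/-! ## Cells and slices -/

/-- Check the certificates of a list of cells `(s, mode)` against their contexts (branch `none`). [folklore] -/
def cellsOK (d : List ℕ) (ord : List Atom) : List (Bool × Mode) → List Top → Bool
  | [], [] => true
  | (s, m) :: sm, ct :: cs => m.ok && topOK (mkCtx d ord s m none) ct && cellsOK d ord sm cs
  | _, _ => false

/-- Check a slice of cells of a support: compute and verify the 2-Sidon order, then every listed cell. [folklore] -/
def checkCells (d : List ℕ) (L : List (Bool × Mode)) (certs : List Top) : Bool :=
  let ord := sortAtoms d
  ordOK d ord && cellsOK d ord L certs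

end Summit.ValiantsHypothesis.ValiantsHypothesis.Theorems.LacunarySymmetroidMatrixDescartes.Census.V19T
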